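import Mathlib
import Summits.Ventures.HodgeRepro2.T6N5Skeleton
import Summits.Ventures.HodgeRepro2.T6N5Level
import Summits.Ventures.HodgeRepro2.T6N5LocalDatum
import Summits.Ventures.HodgeRepro2.T6N5Local
import Summits.Ventures.HodgeRepro2.T6N5LocalSidesPlaces

/-!
# T6N5Rich — the RICH N5 datum: the toric sides of N5 built from a representation carrier per side and
a per-place sign model, on which the three M2 residual binders `hL5` / `ha5` / `hb5` of
`periodInputN_of_published₆` (N5.L1 ×2, (a) ×2, (b) ×2 — class IR at M2 v6) are THEOREMS modulo
construction facts of the datum (class EX) and two named residuals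

Tier 6 (README §10), sub-step N5 of the M2 discharge (t6-p7 with t6-p8).  At M2 v6 (T6PeriodInput6) the
N5 block consumes, on the carrier's datum `M.d5 : N5Skeleton.N5Data` (an ABSTRACT pair of toric sides
whose `periodNonzero` / `levelPeriodNonzero` are bare Props and whose sign tuples are bare functions),
the three interface residuals `hL5 : levelReduction ×2`, `ha5 : condA ×2`, `hb5 : condB ×2`.  Each of
them is a theorem once the sides expose what TIER5's datum (N0.3) actually carries:

* N5.L1 (`levelReduction`, TIER5 §N5.5(a)): the side's period functional `P` lives on the representation
  space `V` of π₀ (resp. π₀′) with its level filtration `fix K` (the K-fixed vectors, K running over the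
  open compact subgroups `κ`) and its τ′-isotypic projector `e`; «P ≢ 0 on π₀» IS `P ≠ 0` and «(ii_X)» IS
  «∃ K, ∃ v ∈ fix K with e v = v and P v ≠ 0».  N5.L1 is then `T6N5Level.exists_level_type_ne_zero`
  from the four facts `RepCarrier.LevelHyps` — smoothness (`⨆ K, fix K = ⊤`), `e` idempotent, `e`
  preserving every `fix K` (the archimedean and finite actions commute), and `P ∘ e = P` (the
  T_X(𝔸)-equivariance of the period, TIER5 §N5.5(a)'s proof) — all PROPERTIES OF THE DATUM BY CONSTRUCTION
  (TIER5 (N0.3): π₀ a smooth automorphic representation, P the toric period, e the isotypic average),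
  class EX in TARGET-T6 §9.5's sense.
* (a) (`condA`, TIER5 §N5.4 row (a), (D4)): β′ is DEFINED as the right side of (a_A) — here
  `RichData.β := f * rA` — so (a_A) holds by `rfl` and (a_B) reduces to the ONE equation
  (S–H) `rA = rB` = «(χ_{111}χ_{100})|_Δ = (χ_{101}χ_{110})|_Δ» (N2 (A5) / (H_χ), proved on the N2 datum
  by t6-p5's `AdmDatum`; its transport to the N5 letters is a dictionary the carrier does not carry —
  `RichData.SH`, the FIRST named residual).
* (b) (`condB`, TIER5 §N5.5 + §N5.11): the sign tuples are DEFINED from a per-place sign model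
  (`SignModel`: the kind of each place — finite non-split / split / real — t6-p8's local sign datum
  `LocalSignDatum` and the datum's line characters `ξ` at the finite non-split places, the two sides'
  real-place signs): at a finite non-split place `omega := ω_{E_v/F_v}(λ_i)` (side B with the `η_v(u)`
  twist, §N5.5(e)) and `eps := ε_v(ξ_i)` — so (b) there IS t6-p8's `LocalSolution` (Theorem N5.T2's
  conclusion; `SignModel.Solves`, the datum's characters CHOSEN as solutions — existence is t6-p8's
  per-place theorems, `exists_signModel` below is the kernel witness of the choice); at a split place
  both signs are `1` by definition ([Bo-eps-tuple] l. 6; ω of a split algebra); at a real place (b) is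
  the route's residual (MEMO §10.4(C) via Rem. 5.7; `SignModel.RealCondB`, the SECOND named residual).
  The gluing is t6-p8's `T6N5LocalSidesPlaces.condB_of_places_A` / `_B` (p407923), consumed by name.

`RichData.toN5Data` is the skeleton pair the carrier holds; `RichData.residuals` delivers exactly the
three v6 binders.  No display lives here (no `[cite:` docstring); nothing automorphic is constructed.
§8(d): uses an L-value-free non-vanishing device: NO.
-/

namespace Summit.Ventures.HodgeRepro2.T6.N5Rich

open Summit.Ventures.HodgeRepro2.T6.N5Skeleton Summit.Ventures.HodgeRepro2.T6.N5LocalDatum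
  Summit.Ventures.HodgeRepro2.T6.N5Local

/-- The kind of a place `v` of `F` relative to the quadratic extension `E/F` (TIER5 §N5.5 / §N5.11):
finite non-split (`ns`: inert or ramified — the places of Theorem N5.T2), split (`sp`), or real (`re`). -/
inductive PlaceKind
  /-- a finite place of `F` non-split in `E` -/
  | ns
  /-- a finite place of `F` split in `E` -/
  | sp
  /-- a real place of `F` -/
  | re
  deriving DecidableEq

namespace PlaceKind

/-- Case selection on a place kind: the value `a` at a finite non-split place, `b` at a split place,
`c` at a real place. -/
def pick {α : Type*} (k : PlaceKind) (a b c : α) : α :=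
  match k with
  | ns => a
  | sp => b
  | re => c

/-- `pick` at a finite non-split place. -/
@[simp] theorem pick_ns {α : Type*} (a b c : α) : pick ns a b c = a := rfl

/-- `pick` at a split place. -/
@[simp] theorem pick_sp {α : Type*} (a b c : α) : pick sp a b c = b := rfl

/-- `pick` at a real place. -/
@[simp] theorem pick_re {α : Type*} (a b c : α) : pick re a b c = c := rfl

end PlaceKind

/-- THE REPRESENTATION CARRIER of one toric side X ∈ {A, B} (TIER5 §N5.5(a), the objects of Lemma N5.L1):
the space `V` of the automorphic representation π₀ (resp. π₀′), the level filtration `fix K` (the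
`K`-fixed vectors, `K : κ` running over the open compact subgroups of U(W_X)(𝔸_f)), the τ′-isotypic
projector `e` (the χ_{X,∞}-isotypic average under K_{∞,2} × K_{∞,3}), and the toric period functional
`P = P_{T_X,χ_X}`.  Data only. -/
structure RepCarrier where
  /-- the representation space of π₀ (resp. π₀′) -/
  V : Type
  [instAdd : AddCommGroup V]
  [instMod : Module ℂ V]
  /-- the index type of the open compact subgroups K ⊂ U(W_X)(𝔸_f) -/
  κ : Type
  /-- the `K`-fixed vectors π₀^K -/
  fix : κ → Submodule ℂ V
  /-- the τ′-isotypic projector -/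
  e : V →ₗ[ℂ] V
  /-- the toric period functional P_{T_X,χ_X} on π₀ -/
  P : V →ₗ[ℂ] ℂ

namespace RepCarrier

variable (C : RepCarrier)

/-- the additive group of the representation space (field) -/
instance : AddCommGroup C.V := C.instAdd

/-- the ℂ-module structure of the representation space (field) -/
instance : Module ℂ C.V := C.instMod

/-- «P_{T_X,χ_X} is not identically zero on π₀»: the functional is non-zero. -/
def periodNonzero : Prop := C.P ≠ 0

/-- (ii_X) (TIER5 §N5.1): «there is an open compact K₀ such that P_{T_X,χ_X} is not identically zero on
π₀^{K₀,τ′}» — some `K`-fixed vector of type τ′ (`e v = v`) has `P v ≠ 0`. -/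
def levelPeriodNonzero : Prop := ∃ K, ∃ v ∈ C.fix K, C.e v = v ∧ C.P v ≠ 0

/-- The four facts of the datum that Lemma N5.L1's proof uses (TIER5 §N5.5(a)) — properties of the
construction of (N0.3) (class EX on the M2 line): smoothness of π₀ (every vector is fixed by some open
compact subgroup), `e` is a projector, `e` preserves every level (the archimedean and finite actions
commute), and the period factors through `e` (T_X(𝔸)-equivariance of P). -/
structure LevelHyps : Prop where
  /-- smoothness: the level filtration exhausts `V` -/
  smooth : ⨆ K, C.fix K = ⊤
  /-- the τ′-projector is idempotent -/
  projector : ∀ v, C.e (C.e v) = C.e v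
  /-- the τ′-projector preserves every level -/
  stable : ∀ K, ∀ v ∈ C.fix K, C.e v ∈ C.fix K
  /-- the period factors through the τ′-projector (equivariance) -/
  equivariant : ∀ v, C.P (C.e v) = C.P v

/-- LEMMA N5.L1 on the carrier: from `P ≠ 0` and the four construction facts, some level-`K` vector of
type τ′ has `P v ≠ 0` (`T6N5Level.exists_level_type_ne_zero`). -/
theorem levelPeriodNonzero_of (h : C.LevelHyps) (hP : C.periodNonzero) : C.levelPeriodNonzero :=
  N5Level.exists_level_type_ne_zero C.fix h.smooth C.e h.projector h.stable C.P h.equivariant hP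

end RepCarrier

/-- THE PER-PLACE SIGN MODEL of the two sides (TIER5 §N5.5, §N5.11): the kind of every place `v : ι` of
`F`, t6-p8's local sign datum `D v` (meaningful at the finite non-split places), the datum's four line
characters `ξ v = (ξ_a, ξ_b, ξ_c, ξ_d)` there ((D3)/(D6); Theorem N5.T2's solutions), and the real-place
signs of the two sides (`omegaRA`/`epsRA` for side A's lines (111, 100), `omegaRB`/`epsRB` for side B's
lines (101, 110)).  Data only. -/
structure SignModel (ι : Type*) where
  /-- the kind of each place -/
  kind : ι → PlaceKind
  /-- the local sign datum at each place (used at the finite non-split places) -/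
  D : ι → LocalSignDatum
  /-- the datum's line characters at each place -/
  ξ : ∀ v, Fin 4 → (D v).Char
  /-- side A's ω_v(λ_i) at the real places -/
  omegaRA : ι → Fin 2 → ℤˣ
  /-- side A's ε_v(ξ_i, ψ_v, δ) at the real places -/
  epsRA : ι → Fin 2 → ℤˣ
  /-- side B's ω_v(λ_i) at the real places -/
  omegaRB : ι → Fin 2 → ℤˣ
  /-- side B's ε_v(ξ_i, ψ_v, δ) at the real places -/
  epsRB : ι → Fin 2 → ℤˣ

namespace SignModel

variable {ι : Type*} (S : SignModel ι)

/-- Side A's tuple ω_v(λ_i) (lines a = 111, b = 100): `ω_{E_v/F_v}(λ_i)` at a finite non-split place, `1`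
at a split place, the real-place datum at a real place. -/
def omegaA (v : ι) (i : Fin 2) : ℤˣ := (S.kind v).pick ((S.D v).ηLine i) 1 (S.omegaRA v i)

/-- Side A's tuple ε_v(ξ_i, ψ_v, δ): `ε_v(ξ_i)` of the datum's characters `ξ_a = ξ v 0`, `ξ_b = ξ v 1` at a
finite non-split place, `1` at a split place ([Bo-eps-tuple] l. 6), the real-place datum at a real place. -/
def epsA (v : ι) (i : Fin 2) : ℤˣ :=
  (S.kind v).pick ((S.D v).eps (S.ξ v (Fin.castLE (by decide) i))) 1 (S.epsRA v i)

/-- Side B's tuple ω_v(λ_i) (lines c = 101, d = 110): `η_v(u)·ω_{E_v/F_v}(λ_i)` at a finite non-split place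
(TIER5 §N5.5(e)), `1` at a split place, the real-place datum at a real place. -/
def omegaB (v : ι) (i : Fin 2) : ℤˣ :=
  (S.kind v).pick ((S.D v).ηu * (S.D v).ηLine i) 1 (S.omegaRB v i)

/-- Side B's tuple ε_v(ξ_i, ψ_v, δ): `ε_v(ξ_i)` of `ξ_c = ξ v 2`, `ξ_d = ξ v 3` at a finite non-split place,
`1` at a split place, the real-place datum at a real place. -/
def epsB (v : ι) (i : Fin 2) : ℤˣ :=
  (S.kind v).pick ((S.D v).eps (S.ξ v (i.addNat 2))) 1 (S.epsRB v i)

/-- THE DATUM'S CHARACTERS SOLVE THE COUPLED LOCAL SYSTEM at every finite non-split place (Theorem N5.T2's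
conclusion, t6-p8's `LocalSolution`: `(b_A)_v`, `(b_B)_v`, `(S–H)_v`) — the (D-ξ) choice of TIER5 §N5.11;
existence at each such place is t6-p8's per-place theorems, `exists_signModel` the kernel witness of the
choice (class EX). -/
def Solves : Prop := ∀ v, S.kind v = .ns → LocalSolution (S.D v) (S.ξ v)

/-- CONDITION (b) AT THE REAL PLACES, both sides (the route's residual: MEMO §10.4(C) via Rem. 5.7 — the
S–E weights; class IR). -/
def RealCondB : Prop :=
  ∀ v, S.kind v = .re → ∀ i : Fin 2, S.omegaRA v i = S.epsRA v i ∧ S.omegaRB v i = S.epsRB v i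

/-- The finite non-split places. -/
def NS : Set ι := {v | S.kind v = .ns}

/-- The split places. -/
def Sp : Set ι := {v | S.kind v = .sp}

/-- The real places. -/
def Re : Set ι := {v | S.kind v = .re}

/-- Every place is of exactly one of the three kinds (the cover of `condB_of_places`). -/
theorem cover (v : ι) : v ∈ S.NS ∨ v ∈ S.Sp ∨ v ∈ S.Re := by
  rcases h : S.kind v with _ | _ | _
  · exact Or.inl h
  · exact Or.inr (Or.inl h)
  · exact Or.inr (Or.inr h)

/-- The local (S–H) identity `ξ_c ξ_d = ξ_a ξ_b` at every finite non-split place, from `Solves`. -/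
theorem localSH (hsol : S.Solves) (v : ι) (hv : S.kind v = .ns) :
    S.ξ v 2 * S.ξ v 3 = S.ξ v 0 * S.ξ v 1 :=
  (hsol v hv).2.2.2.2.2

end SignModel

/-- THE RICH N5 DATUM: the two representation carriers, the sign model, the common factor
`f = (ξ′_A⁻²·ξ_A)∘j⁻¹` of (a) (the same on both sides — (H_χ), N2 (A5); the skeleton's `same_f`), the two
diagonal restrictions `rA = (χ_{111}χ_{100})|_Δ`, `rB = (χ_{101}χ_{110})|_Δ`, and the central values of
the four line characters.  β′ is NOT a field: it is DEFINED as the right side of (a_A) (TIER5 (D4)). -/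
structure RichData (ι G : Type*) [CommGroup G] where
  /-- the representation carrier of side A (π₀, T_A, χ_A) -/
  repA : RepCarrier
  /-- the representation carrier of side B (π₀′, T_B, χ_B) -/
  repB : RepCarrier
  /-- the per-place sign model of both sides -/
  S : SignModel ι
  /-- the factor (ξ′_A⁻²·ξ_A)∘j⁻¹ of condition (a), common to both sides -/
  f : G
  /-- side A's diagonal restriction (χ_{111}χ_{100})|_{E¹_Δ(𝔸)} -/
  rA : G
  /-- side B's diagonal restriction (χ_{101}χ_{110})|_{E¹_Δ(𝔸)} -/
  rB : G
  /-- side A's central values L(½, ξ_a), L(½, ξ_b) -/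
  LvalA : Fin 2 → ℂ
  /-- side B's central values L(½, ξ_c), L(½, ξ_d) -/
  LvalB : Fin 2 → ℂ

namespace RichData

variable {ι G : Type*} [CommGroup G] (R : RichData ι G)

/-- β′ := (ξ′_A⁻²·ξ_A)∘j⁻¹ · (χ_{111}χ_{100})|_Δ — TIER5 (D4): the character of [E¹] DEFINED so that (a_A)
holds. -/
def β : G := R.f * R.rA

/-- Side A of the datum as a toric side of the skeleton: the period statements from the representation
carrier, β′ from (D4), the sign tuples from the sign model. -/
def sideA : ToricSide ι G where
  periodNonzero := R.repA.periodNonzero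
  levelPeriodNonzero := R.repA.levelPeriodNonzero
  β := R.β
  f := R.f
  r := R.rA
  omega := R.S.omegaA
  eps := R.S.epsA
  Lval := R.LvalA

/-- Side B of the datum as a toric side of the skeleton (the SAME β′ and the same factor `f`). -/
def sideB : ToricSide ι G where
  periodNonzero := R.repB.periodNonzero
  levelPeriodNonzero := R.repB.levelPeriodNonzero
  β := R.β
  f := R.f
  r := R.rB
  omega := R.S.omegaB
  eps := R.S.epsB
  Lval := R.LvalB

/-- The skeleton pair the composition carrier holds (`NAut3.d5`): the two sides with the same β′ and the
same factor, both by `rfl`. -/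
def toN5Data : N5Data ι G where
  A := R.sideA
  B := R.sideB
  same_β := rfl
  same_f := rfl

/-- The (S–H) equation «(χ_{111}χ_{100})|_Δ = (χ_{101}χ_{110})|_Δ» (TIER5 §N5.5(b); N2 (A5) / (H_χ)) in the N5
letters — the residual of (a_B) (class IR on the M2 line: the dictionary between t6-p5's N2 datum, on
which (H_χ) is a theorem, and the N5 letters is not a carrier field). -/
def SH : Prop := R.rA = R.rB

/-- The construction facts of both representation carriers (class EX). -/
def LevelHyps : Prop := R.repA.LevelHyps ∧ R.repB.LevelHyps

/-- Lemma N5.L1 on side A, from the construction facts. -/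
theorem sideA_levelReduction (h : R.repA.LevelHyps) : R.sideA.levelReduction :=
  fun hP => R.repA.levelPeriodNonzero_of h hP

/-- Lemma N5.L1 on side B, from the construction facts. -/
theorem sideB_levelReduction (h : R.repB.LevelHyps) : R.sideB.levelReduction :=
  fun hP => R.repB.levelPeriodNonzero_of h hP

/-- (a_A) holds by the definition of β′ ((D4)). -/
theorem sideA_condA : R.sideA.condA := rfl

/-- (a_B) holds from (D4) and (S–H). -/
theorem sideB_condA (h : R.SH) : R.sideB.condA := by
  show R.β = R.f * R.rB
  rw [← h]
  rfl

/-- (b) on side A from the datum's local solutions at the finite non-split places, the definitional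
split values, and (b) at the real places — t6-p8's `condB_of_places_A` consumed by name. -/
theorem sideA_condB (hsol : R.S.Solves) (hre : R.S.RealCondB) : R.sideA.condB := by
  refine N5LocalSidesPlaces.condB_of_places_A R.sideA R.S.NS R.S.Sp R.S.Re R.S.cover R.S.D R.S.ξ
    (fun v hv => hsol v hv) ?_ ?_ ?_ ?_ ?_
  · intro v hv i
    show (R.S.kind v).pick _ _ _ = _
    rw [hv, PlaceKind.pick_ns]
  · intro v hv i
    show (R.S.kind v).pick _ _ _ = _
    rw [hv, PlaceKind.pick_ns]
  · intro v hv i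
    show (R.S.kind v).pick _ _ _ = _
    rw [hv, PlaceKind.pick_sp]
  · intro v hv i
    show (R.S.kind v).pick _ _ _ = _
    rw [hv, PlaceKind.pick_sp]
  · intro v hv i
    show (R.S.kind v).pick _ _ _ = (R.S.kind v).pick _ _ _
    rw [hv, PlaceKind.pick_re, PlaceKind.pick_re]
    exact (hre v hv i).1

/-- (b) on side B, the same way through t6-p8's `condB_of_places_B` (the `η_v(u)` pattern). -/
theorem sideB_condB (hsol : R.S.Solves) (hre : R.S.RealCondB) : R.sideB.condB := by
  refine N5LocalSidesPlaces.condB_of_places_B R.sideB R.S.NS R.S.Sp R.S.Re R.S.cover R.S.D R.S.ξ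
    (fun v hv => hsol v hv) ?_ ?_ ?_ ?_ ?_
  · intro v hv i
    show (R.S.kind v).pick _ _ _ = _
    rw [hv, PlaceKind.pick_ns]
  · intro v hv i
    show (R.S.kind v).pick _ _ _ = _
    rw [hv, PlaceKind.pick_ns]
  · intro v hv i
    show (R.S.kind v).pick _ _ _ = _
    rw [hv, PlaceKind.pick_sp]
  · intro v hv i
    show (R.S.kind v).pick _ _ _ = _
    rw [hv, PlaceKind.pick_sp]
  · intro v hv i
    show (R.S.kind v).pick _ _ _ = (R.S.kind v).pick _ _ _
    rw [hv, PlaceKind.pick_re, PlaceKind.pick_re]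
    exact (hre v hv i).2

/-- THE THREE M2 RESIDUAL BINDERS OF N5 (v6: `hL5`, `ha5`, `hb5`) AS ONE THEOREM on the rich datum: Lemma
N5.L1 on both sides from the construction facts, (a) on both sides from (D4) + (S–H), (b) on both sides
from the datum's local solutions + the split values + (b) at the real places. -/
theorem residuals (hL : R.LevelHyps) (hSH : R.SH) (hsol : R.S.Solves) (hre : R.S.RealCondB) :
    (R.toN5Data.A.levelReduction ∧ R.toN5Data.B.levelReduction) ∧
      (R.toN5Data.A.condA ∧ R.toN5Data.B.condA) ∧
      (R.toN5Data.A.condB ∧ R.toN5Data.B.condB) :=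
  ⟨⟨R.sideA_levelReduction hL.1, R.sideB_levelReduction hL.2⟩,
    ⟨R.sideA_condA, R.sideB_condA hSH⟩,
    ⟨R.sideA_condB hsol hre, R.sideB_condB hsol hre⟩⟩

/-- N5 for the rich datum: Theorem 5.6's shape on both sides, the construction facts, (S–H), the local
solutions, (b) at the real places, and (c) give N5 (`N5Data.N5_of_residual`). -/
theorem N5_of (hTA : R.sideA.dichotomy) (hTB : R.sideB.dichotomy) (hL : R.LevelHyps) (hSH : R.SH)
    (hsol : R.S.Solves) (hre : R.S.RealCondB) (hc : R.toN5Data.condC) : R.toN5Data.N5 :=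
  N5Data.N5_of_residual hTA hTB (R.sideA_levelReduction hL.1) (R.sideB_levelReduction hL.2)
    R.sideA_condA (R.sideB_condA hSH) (R.sideA_condB hsol hre) (R.sideB_condB hsol hre) hc

end RichData

/-- THE KERNEL WITNESS OF THE (D-ξ) CHOICE (class EX made explicit): if the coupled local system is
solvable at every finite non-split place (t6-p8's per-place theorems), then for any kinds, local data and
real-place signs there is a sign model with those fields whose characters solve it
(`SignModel.Solves`). -/
theorem exists_signModel {ι : Type*} (kind : ι → PlaceKind) (D : ι → LocalSignDatum)
    (h : ∀ v, kind v = .ns → ∃ ξ : Fin 4 → (D v).Char, LocalSolution (D v) ξ)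
    (oA eA oB eB : ι → Fin 2 → ℤˣ) :
    ∃ S : SignModel ι, S.kind = kind ∧ S.D = D ∧ S.omegaRA = oA ∧ S.epsRA = eA ∧ S.omegaRB = oB ∧
      S.epsRB = eB ∧ S.Solves := by
  classical
  refine ⟨SignModel.mk kind D
      (fun v => if hv : kind v = PlaceKind.ns then (h v hv).choose else fun _ => 1) oA eA oB eB,
    rfl, rfl, rfl, rfl, rfl, rfl, ?_⟩
  intro v hv
  have hv' : kind v = PlaceKind.ns := hv
  show LocalSolution (D v) (if hv : kind v = PlaceKind.ns then (h v hv).choose else fun _ => 1)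
  rw [dif_pos hv']
  exact (h v hv').choose_spec

end Summit.Ventures.HodgeRepro2.T6.N5Rich
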